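import Mathlib
import Literature.NumberTheory.LFunctions.KloostermanWeilPrimeProofs
import HarnessLib

/-!
# Kloosterman sums to a prime modulus as twisted quadratic-character sums — PROVED

Topic `NumberTheory/LFunctions` (exponential sums), on the tree's
`Literature.NumberTheory.LFunctions.kloostermanSum p 1 n = ∑_{x ∈ (ℤ/pℤ)ˣ} e((x + n x̄)/p)` for an
odd prime `p`.  Two classical identities (Salié; Conrey–Iwaniec 2000, (14.7); Kunisky–Yu 2022,
Proposition 4.11 and (129)) expressing Kloosterman sums through the quadratic character
`χ = quadraticChar (ZMod p)` and conversely: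

* `kloostermanSum_one_eq_sum_quadraticChar`:  `S(1, n; p) = ∑_s χ(s² − 4n) e(s/p)` for EVERY
  `n ∈ ℤ/pℤ` (for `n = 0` both sides are the Ramanujan sum `−1`);
* `sum_quadraticChar_mul_sub_mul_stdAddChar`:  for `t ≠ 0` and every `r`,
  `∑_y χ(y(y − t)) e(ry/p) = e(rt/2p) · S(1, (rt/4)²; p)` — the additive Fourier transform of the
  "shifted quadratic character" `y ↦ χ(y(y − t))` is a Kloosterman sum at a square
  (Kunisky–Yu 2022, Proposition 4.11: `∑_x χ(x² − 1) e(2ax/p) = K(a²)`).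

Proof of the first: `χ(s² − 4n) + 1 = #{y : y² = s² − 4n}` (`quadraticChar_card_sqrts`), so the
right side is `∑_{(s,y) : y² = s² − 4n} e(s)` (the `+1` contributes `∑_s e(s) = 0`); the linear
change of variables `(s, y) = (u + v, u − v)` (valid for `p` odd) turns `y² = s² − 4n` into
`uv = n` and `e(s)` into `e(u + v)`, and `∑_{uv = n} e(u + v) = S(1, n; p)`.  The second follows by
completing the square.  Also recorded: `S(1, 0; p) = −1`, `S(1, n; p)` is real
(`conj S = S`), and the uniform bound `‖S(1, n; p)‖ ≤ 2 √p` for all `n` (Weil's bound, PROVED in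
the tree as `weil_kloosterman_bound_prime_holds`, and `|−1| ≤ 2√p` at `n = 0`).

These identities feed the Kunisky–Yu norm bound for the graph matrix `T^{4,4,1}` of the Paley graph
(`Literature/Combinatorics/SimpleGraph/PaleyT441*.lean`).

## References

* H. Salié, *Über die Kloostermanschen Summen S(u, v; q)*, Math. Z. 34 (1932), 91–109.
* J. B. Conrey, H. Iwaniec, *The cubic moment of central values of automorphic L-functions*,
  Ann. of Math. 151 (2000), (14.7).
* D. Kunisky, X. Yu, arXiv:2211.02713 (2022), Proposition 4.11, (129)–(130).  [KuniskyYu2022]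
-/

noncomputable section

open Finset

namespace Literature.NumberTheory.LFunctions

section Prime

variable {p : ℕ} [hp : Fact p.Prime]

/-- Counting square roots with the quadratic character, as a complex-valued sum:
`∑_y [y² = a] = χ(a) + 1`. [folklore] -/
theorem sum_ite_sq_eq_quadraticChar_add_one (hp2 : p ≠ 2) (a : ZMod p) :
    (∑ y : ZMod p, if y ^ 2 = a then (1 : ℂ) else 0) = quadraticChar (ZMod p) a + 1 := by
  have hF : ringChar (ZMod p) ≠ 2 := by rwa [ZMod.ringChar_zmod_n]
  have h := quadraticChar_card_sqrts hF a
  rw [Set.toFinset_setOf] at h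
  rw [Finset.sum_boole]
  have h' : (((Finset.univ.filter fun x : ZMod p => x ^ 2 = a).card : ℤ) : ℂ) =
      ((quadraticChar (ZMod p) a + 1 : ℤ) : ℂ) := by rw [h]
  push_cast at h'
  exact h'

/-- Reindexing a sum over squares: `∑_y f(y²) = ∑_a (χ(a) + 1) f(a)`. [folklore] -/
theorem sum_comp_sq_eq_sum_quadraticChar_add_one_mul (hp2 : p ≠ 2) (f : ZMod p → ℂ) :
    ∑ y : ZMod p, f (y ^ 2) = ∑ a : ZMod p, (quadraticChar (ZMod p) a + 1) * f a := by
  calc ∑ y : ZMod p, f (y ^ 2)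
      = ∑ y : ZMod p, ∑ a : ZMod p, (if y ^ 2 = a then (1 : ℂ) else 0) * f a := by
        refine Finset.sum_congr rfl fun y _ => ?_
        simp only [ite_mul, one_mul, zero_mul, Finset.sum_ite_eq, Finset.mem_univ, if_true]
    _ = ∑ a : ZMod p, (∑ y : ZMod p, (if y ^ 2 = a then (1 : ℂ) else 0)) * f a := by
        rw [Finset.sum_comm]
        refine Finset.sum_congr rfl fun a _ => ?_
        rw [Finset.sum_mul]
    _ = ∑ a : ZMod p, (quadraticChar (ZMod p) a + 1) * f a := by
        refine Finset.sum_congr rfl fun a _ => ?_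
        rw [sum_ite_sq_eq_quadraticChar_add_one hp2]

/-- The sum of the standard additive character over `ℤ/pℤ` vanishes. [folklore] -/
theorem sum_stdAddChar_eq_zero : ∑ s : ZMod p, (ZMod.stdAddChar s : ℂ) = 0 := by
  have h1 : (ZMod.stdAddChar : AddChar (ZMod p) ℂ) ≠ 1 := by
    rw [AddChar.ne_one_iff]
    refine ⟨1, ?_⟩
    rw [← (ZMod.stdAddChar (N := p)).map_zero_eq_one, Ne, ZMod.injective_stdAddChar.eq_iff]
    exact one_ne_zero
  exact AddChar.sum_eq_zero_of_ne_one h1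

/-- The Kloosterman sum `S(1, n; p)` as a sum over the hyperbola `uv = n`:
`S(1, n; p) = ∑_{u, v : uv = n} e((u + v)/p)` (for `n = 0` the degenerate conic `uv = 0` also
gives `−1`). [folklore] -/
theorem kloostermanSum_one_eq_sum_hyperbola (n : ZMod p) :
    kloostermanSum p 1 n =
      ∑ u : ZMod p, ∑ v : ZMod p, if u * v = n then (ZMod.stdAddChar (u + v) : ℂ) else 0 := by
  classical
  unfold kloostermanSum
  refine Finset.sum_congr rfl fun u _ => ?_
  by_cases hu : u = 0
  · subst hu
    simp only [isUnit_zero_iff, zero_ne_one, if_false, zero_mul, zero_add]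
    by_cases hn : (0 : ZMod p) = n
    · simp only [hn, if_true]
      rw [← hn] at *
      exact (sum_stdAddChar_eq_zero (p := p)).symm
    · simp only [hn, if_false, Finset.sum_const_zero]
  · have hu' : IsUnit u := isUnit_iff_ne_zero.mpr hu
    rw [if_pos hu', one_mul]
    have hkey : ∀ v : ZMod p, u * v = n ↔ v = n * u⁻¹ := by
      intro v
      constructor
      · intro h
        rw [← h, mul_comm u v, mul_assoc, mul_inv_cancel₀ hu, mul_one]
      · intro h
        rw [h, mul_comm n, ← mul_assoc, mul_inv_cancel₀ hu, one_mul]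
    simp_rw [hkey]
    rw [Finset.sum_ite_eq' Finset.univ (n * u⁻¹)]
    simp

/-- **Kloosterman sums through the quadratic character** (Salié; Conrey–Iwaniec (14.7);
Kunisky–Yu 2022, Proposition 4.11): for an odd prime `p` and every `n ∈ ℤ/pℤ`,
`S(1, n; p) = ∑_s χ(s² − 4n) e(s/p)`. [cite: KuniskyYu2022, Proposition 4.11] -/
theorem kloostermanSum_one_eq_sum_quadraticChar (hp2 : p ≠ 2) (n : ZMod p) :
    kloostermanSum p 1 n =
      ∑ s : ZMod p, (quadraticChar (ZMod p) (s ^ 2 - 4 * n) : ℂ) * ZMod.stdAddChar s := by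
  classical
  have hF : ringChar (ZMod p) ≠ 2 := by rwa [ZMod.ringChar_zmod_n]
  have h2 : (2 : ZMod p) ≠ 0 := Ring.two_ne_zero hF
  -- right side as a sum over the conic `y² = s² - 4n`
  have hR : ∑ s : ZMod p, (quadraticChar (ZMod p) (s ^ 2 - 4 * n) : ℂ) * ZMod.stdAddChar s =
      ∑ s : ZMod p, ∑ y : ZMod p,
        if y ^ 2 = s ^ 2 - 4 * n then (ZMod.stdAddChar s : ℂ) else 0 := by
    have hs : ∀ s : ZMod p, (quadraticChar (ZMod p) (s ^ 2 - 4 * n) : ℂ) * ZMod.stdAddChar s =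
        (∑ y : ZMod p, if y ^ 2 = s ^ 2 - 4 * n then (ZMod.stdAddChar s : ℂ) else 0) -
          ZMod.stdAddChar s := by
      intro s
      have h1 := sum_ite_sq_eq_quadraticChar_add_one hp2 (s ^ 2 - 4 * n)
      have h3 : (∑ y : ZMod p, if y ^ 2 = s ^ 2 - 4 * n then (ZMod.stdAddChar s : ℂ) else 0) =
          (∑ y : ZMod p, if y ^ 2 = s ^ 2 - 4 * n then (1 : ℂ) else 0) * ZMod.stdAddChar s := by
        rw [Finset.sum_mul]
        refine Finset.sum_congr rfl fun y _ => ?_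
        split_ifs <;> simp
      rw [h3, h1]
      ring
    simp_rw [hs]
    rw [Finset.sum_sub_distrib, sum_stdAddChar_eq_zero, sub_zero]
  rw [hR, kloostermanSum_one_eq_sum_hyperbola n]
  -- change of variables `(s, y) = (u + v, u - v)`
  rw [← Fintype.sum_prod_type', ← Fintype.sum_prod_type']
  let e : ZMod p × ZMod p ≃ ZMod p × ZMod p :=
    { toFun := fun uv => (uv.1 + uv.2, uv.1 - uv.2)
      invFun := fun sy => ((sy.1 + sy.2) / 2, (sy.1 - sy.2) / 2)
      left_inv := by
        intro uv
        ext <;> · simp only; field_simp; ring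
      right_inv := by
        intro sy
        ext <;> · simp only; field_simp; ring }
  refine (Fintype.sum_equiv e _ _ fun uv => ?_)
  simp only [e, Equiv.coe_fn_mk]
  have hiff : (uv.1 - uv.2) ^ 2 = (uv.1 + uv.2) ^ 2 - 4 * n ↔ uv.1 * uv.2 = n := by
    constructor
    · intro h
      have h4 : (4 : ZMod p) ≠ 0 := by
        have : (4 : ZMod p) = 2 * 2 := by norm_num
        rw [this]; exact mul_ne_zero h2 h2
      have : 4 * (uv.1 * uv.2) = 4 * n := by linear_combination -h
      exact mul_left_cancel₀ h4 this
    · intro h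
      linear_combination -(4 : ZMod p) * h
  by_cases huv : uv.1 * uv.2 = n
  · rw [if_pos huv, if_pos (hiff.mpr huv)]
  · rw [if_neg huv, if_neg (mt hiff.mp huv)]

/-- The Ramanujan sum: `S(1, 0; p) = ∑_{x ≠ 0} e(x/p) = −1`. [folklore] -/
theorem kloostermanSum_one_zero : kloostermanSum p 1 (0 : ZMod p) = -1 := by
  classical
  unfold kloostermanSum
  have h : ∀ x : ZMod p, (if IsUnit x then (ZMod.stdAddChar (1 * x + 0 * x⁻¹) : ℂ) else 0) =
      ZMod.stdAddChar x - if x = 0 then (1 : ℂ) else 0 := by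
    intro x
    by_cases hx : x = 0
    · subst hx; simp
    · rw [if_pos (isUnit_iff_ne_zero.mpr hx), if_neg hx, one_mul, zero_mul, add_zero, sub_zero]
  simp_rw [h]
  rw [Finset.sum_sub_distrib, sum_stdAddChar_eq_zero, Finset.sum_ite_eq' Finset.univ (0 : ZMod p)]
  simp

/-- Kloosterman sums `S(1, n; p)` are real: `conj S(1, n; p) = S(1, n; p)` (substitute `x ↦ −x`).
[folklore] -/
theorem conj_kloostermanSum_one (n : ZMod p) :
    (starRingEnd ℂ) (kloostermanSum p 1 n) = kloostermanSum p 1 n := by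
  classical
  unfold kloostermanSum
  rw [map_sum]
  refine Fintype.sum_equiv (Equiv.neg (ZMod p)) _ _ fun x => ?_
  simp only [Equiv.neg_apply, IsUnit.neg_iff]
  split_ifs with hx
  · rw [← AddChar.map_neg_eq_conj]
    congr 1
    rw [inv_neg]
    ring
  · simp

/-- **Uniform Weil bound** `‖S(1, n; p)‖ ≤ 2 √p` for every `n ∈ ℤ/pℤ` (Weil 1948 for `n ≠ 0`,
PROVED in the tree as `weil_kloosterman_bound_prime_holds`; `S(1, 0; p) = −1` otherwise).
[folklore] -/
theorem norm_kloostermanSum_one_prime_le (n : ZMod p) :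
    ‖kloostermanSum p 1 n‖ ≤ 2 * Real.sqrt p := by
  by_cases hn : n = 0
  · subst hn
    rw [kloostermanSum_one_zero, norm_neg, norm_one]
    have : (1 : ℝ) ≤ Real.sqrt p := by
      rw [Real.one_le_sqrt]
      exact_mod_cast hp.out.one_lt.le
    linarith
  · exact weil_kloosterman_bound_prime_holds p 1 n one_ne_zero hn

/-- Jacobsthal's sum: `∑_y χ(y(y − t)) = −1` for `t ≠ 0` and `p` odd (via Mathlib's
`J(χ, χ⁻¹) = −χ(−1)`). [folklore] -/
theorem sum_quadraticChar_mul_sub_eq_neg_one (hp2 : p ≠ 2) {t : ZMod p} (ht : t ≠ 0) :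
    ∑ y : ZMod p, (quadraticChar (ZMod p) (y * (y - t)) : ℂ) = -1 := by
  classical
  have hF : ringChar (ZMod p) ≠ 2 := by rwa [ZMod.ringChar_zmod_n]
  -- substitute `y = t x`
  have h1 : ∑ x : ZMod p, (quadraticChar (ZMod p) (t * x * (t * x - t)) : ℂ) =
      ∑ y : ZMod p, (quadraticChar (ZMod p) (y * (y - t)) : ℂ) :=
    Fintype.sum_bijective (t * ·) (mulLeft_bijective₀ t ht) _ _ fun x => rfl
  rw [← h1]
  have h1' : ∀ x : ZMod p, quadraticChar (ZMod p) (t * x * (t * x - t)) =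
      quadraticChar (ZMod p) (x * (x - 1)) := by
    intro x
    have : t * x * (t * x - t) = t ^ 2 * (x * (x - 1)) := by ring
    rw [this, map_mul, quadraticChar_sq_one' ht, one_mul]
  simp_rw [h1']
  -- `∑_x χ(x) χ(x - 1) = χ(-1) J(χ, χ) = χ(-1) · (−χ(−1)) = −1`
  have hJ := jacobiSum_nontrivial_inv (quadraticChar_ne_one hF)
  rw [(quadraticChar_isQuadratic (ZMod p)).inv] at hJ
  unfold jacobiSum at hJ
  have hm1 : (quadraticChar (ZMod p) (-1)) ^ 2 = 1 := quadraticChar_sq_one (neg_ne_zero.mpr one_ne_zero)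
  have h2 : ∀ x : ZMod p, quadraticChar (ZMod p) (x * (x - 1)) =
      quadraticChar (ZMod p) (-1) * (quadraticChar (ZMod p) x * quadraticChar (ZMod p) (1 - x)) := by
    intro x
    rw [← map_mul, ← map_mul]
    congr 1
    ring
  have h3 : ∑ x : ZMod p, quadraticChar (ZMod p) (x * (x - 1)) = -1 := by
    simp_rw [h2]
    rw [← Finset.mul_sum, hJ]
    linear_combination (-1 : ℤ) * hm1
  exact_mod_cast congrArg (fun z : ℤ => (z : ℂ)) h3

/-- **Fourier transform of the shifted quadratic character** (Kunisky–Yu 2022, Proposition 4.11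
and (129): "`∑_x χ(x² − 1) e_p(2ax) = K(a²)`", here after completing the square): for an odd
prime `p`, `t ≠ 0` and every `r`,
`∑_y χ(y(y − t)) e(ry/p) = e(rt/2p) · S(1, (rt/4)²; p)`.
[cite: KuniskyYu2022, Proposition 4.11] -/
theorem sum_quadraticChar_mul_sub_mul_stdAddChar (hp2 : p ≠ 2) {t : ZMod p} (ht : t ≠ 0)
    (r : ZMod p) :
    ∑ y : ZMod p, (quadraticChar (ZMod p) (y * (y - t)) : ℂ) * ZMod.stdAddChar (r * y) =
      ZMod.stdAddChar (r * t / 2) * kloostermanSum p 1 ((r * t / 4) ^ 2) := by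
  classical
  have hF : ringChar (ZMod p) ≠ 2 := by rwa [ZMod.ringChar_zmod_n]
  have h2 : (2 : ZMod p) ≠ 0 := Ring.two_ne_zero hF
  have h4 : (4 : ZMod p) ≠ 0 := by
    have : (4 : ZMod p) = 2 * 2 := by norm_num
    rw [this]; exact mul_ne_zero h2 h2
  by_cases hr : r = 0
  · subst hr
    simp only [zero_mul, zero_div, AddChar.map_zero_eq_one, mul_one, one_mul, ne_eq,
      OfNat.ofNat_ne_zero, not_false_eq_true, zero_pow]
    rw [kloostermanSum_one_zero, sum_quadraticChar_mul_sub_eq_neg_one hp2 ht]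
  rw [kloostermanSum_one_eq_sum_quadraticChar hp2, Finset.mul_sum]
  have key : ∀ y : ZMod p,
      (quadraticChar (ZMod p) (y * (y - t)) : ℂ) * ZMod.stdAddChar (r * y) =
        ZMod.stdAddChar (r * t / 2) *
          ((quadraticChar (ZMod p) ((r * y - r * t / 2) ^ 2 - 4 * (r * t / 4) ^ 2) : ℂ) *
            ZMod.stdAddChar (r * y - r * t / 2)) := by
    intro y
    have hq : (r * y - r * t / 2) ^ 2 - 4 * (r * t / 4) ^ 2 = r ^ 2 * (y * (y - t)) := by
      field_simp
      ring
    rw [hq, _root_.map_mul (quadraticChar (ZMod p)) (r ^ 2) (y * (y - t)),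
      quadraticChar_sq_one' hr, one_mul]
    have he : (ZMod.stdAddChar (r * y) : ℂ) =
        ZMod.stdAddChar (r * t / 2) * ZMod.stdAddChar (r * y - r * t / 2) := by
      rw [← AddChar.map_add_eq_mul]
      congr 1
      ring
    rw [he]
    ring
  simp_rw [key]
  -- the affine substitution `s = r y - r t / 2`
  let φ : ZMod p ≃ ZMod p := (Equiv.mulLeft₀ r hr).trans (Equiv.subRight (r * t / 2))
  exact Equiv.sum_comp φ (fun s => (ZMod.stdAddChar (r * t / 2) : ℂ) *
    ((quadraticChar (ZMod p) (s ^ 2 - 4 * (r * t / 4) ^ 2) : ℂ) * ZMod.stdAddChar s))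

end Prime

end Literature.NumberTheory.LFunctions

end
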